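import Summits.ResolutionOfSingularities.ResolutionOfSingularities.Theorems.ValuativeLuAlphaPTorsorKnownRanges
import Literature.AlgebraicGeometry.Resolution.QuadraticTransforms
import Literature.AlgebraicGeometry.Resolution.RsopMonomialIdeals
import Literature.AlgebraicGeometry.Resolution.ArithmeticalThreefoldsMonomials
import HarnessLib

/-!
# Crux `Steer`, line `switching-dichotomy`: the archimedean assembly (stub `stub_switchingAssembly`)

We prove `stub_switchingAssembly`: the three worker stubs of the line (`stub_rsopMonomialStep`,
`stub_switchingSetup`, `stub_switchingExit`, taken verbatim as hypotheses `h₁ h₂ h₃`) imply the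
defectless range of the crux — for an `α_p`-torsor datum `(O, A₀, t)` (`t ^ p ∈ A₀`, base regular
at the centre of `O`) which is STRONGLY SWITCHING (the quadratic sequence `R 0 ⊆ R 1 ⊆ ⋯` of the
base along `O` exhausts `O ∩ Frac A₀`), ARCHIMEDEAN on `Frac A₀` and NOT a defect datum, the
conclusion of torsor local uniformization holds.

The argument (Heinzer–Loper–Olberding–Schoutens–Toeniskoetter = [HeinzerEtAl2015], Prop. 4.4, rank-one
case, made elementary):

* fractions of elements of `A₀` are exactly the members of the subfield `Frac A₀ ⊆ K` generated by
  `A₀` (`exists_div_iff_mem_closure`), hence closed under the field operations;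
* the defectless witness `g ∈ Frac A₀` (no `w ∈ Frac A₀` has `v(t ^ p − g ^ p) = v(w ^ p)`) lies in
  `O` — otherwise `v(t ^ p − g ^ p) = v((t − g) ^ p) = v(g ^ p)` —, `b := t ^ p − g ^ p` is non-zero
  of value `< 1` (`w := 0`, `w := 1`), so the centre of `O` on `A₀` is non-zero and `h₂` provides
  the quadratic sequence `R` (regular, dominated by `O`, inside `Frac A₀`);
* strong switching puts `g` in some `R i₀`; a member `x₀` of a regular system of parameters of
  `R i₀` (`exists_isRsopPart_one`) has value `< 1`, so archimedeanity gives `n` with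
  `v(x₀ ^ n) < v(b)`, and `c := x₀ ^ n / b ∈ O ∩ Frac A₀` lies in some `R N₁`; in `R N`,
  `N := i₀ + N₁`, we have `b · c = x₀ ^ n` with `x₀` a monomial in a part of a regular system of
  parameters of `R N` times a unit (`exists_monomial_along`, iterating `h₁` along the sequence);
* `R N` is a domain and the parameters are prime, so the divisor `b` of that monomial is itself a
  monomial times a unit (`exists_monomial_of_mul_eq`, from `exists_eq_units_mul_prod_pow_of_dvd`);
* were all its exponents divisible by `p`, `b = w ^ p · unit` with `w ∈ R N ⊆ Frac A₀` and
  `v(b) = v(w ^ p)`, contradicting defectlessness; so some exponent is prime to `p` and `h₃` exits.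

Sources: W. Heinzer, K. A. Loper, B. Olberding, H. Schoutens, M. Toeniskoetter, *Ideal theory of
infinite directed unions of local quadratic transforms*, arXiv:1505.06445, Prop. 4.4 and
Discussion 4.2; D. Shannon, *Monoidal transforms of regular local rings*, Amer. J. Math. 95 (1973).
-/

set_option linter.dupNamespace false

open IsLocalRing
open Literature.AlgebraicGeometry.Resolution

namespace Summit.ResolutionOfSingularities.ResolutionOfSingularities.Theorems.SwitchingDichotomy

section Helpers

variable {K : Type} [Field K]

/-- **Fractions of `A₀` = the subfield generated by `A₀`.** An element of `K` is a quotient `a / b`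
of elements of the subalgebra `A₀` (`b ≠ 0`) iff it lies in `Subfield.closure A₀`. [folklore] -/
theorem exists_div_iff_mem_closure {k : Type} [Field k] [Algebra k K] (A₀ : Subalgebra k K)
    (x : K) : (∃ a ∈ A₀, ∃ b ∈ A₀, b ≠ 0 ∧ x = a / b) ↔ x ∈ Subfield.closure (A₀ : Set K) := by
  constructor
  · rintro ⟨a, ha, b, hb, -, rfl⟩
    exact div_mem (Subfield.subset_closure ha) (Subfield.subset_closure hb)
  · intro hx
    rw [Subfield.mem_closure_iff] at hx
    obtain ⟨y, hy, z, hz, rfl⟩ := hx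
    rw [← Subalgebra.coe_toSubring, Subring.closure_eq] at hy hz
    by_cases hz0 : z = 0
    · exact ⟨0, A₀.zero_mem, 1, A₀.one_mem, one_ne_zero, by rw [hz0, div_zero, zero_div]⟩
    · exact ⟨y, hy, z, hz, hz0, rfl⟩

/-- A unit of a subring `S ⊆ O` has value `1`. [folklore] -/
theorem valuation_eq_one_of_isUnit_subring {O : ValuationSubring K} {S : Subring K}
    (hS : S ≤ O.toSubring) {u : S} (hu : IsUnit u) : O.valuation (u : K) = 1 := by
  obtain ⟨h0, hinv⟩ := (isUnit_subring_iff_inv_mem u).mp hu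
  refine le_antisymm ((O.valuation_le_one_iff _).mpr (hS u.2)) ?_
  have h1 : O.valuation (u : K)⁻¹ ≤ 1 := (O.valuation_le_one_iff _).mpr (hS hinv)
  rwa [map_inv₀, inv_le_one₀ (pos_iff_ne_zero.mpr ((map_ne_zero _).mpr h0))] at h1

/-- A regular local ring with non-zero maximal ideal has a one-element part of a regular system
of parameters (any member of a minimal basis of `𝔪`). [cite: Matsumura1987, Thm. 14.2] -/
theorem exists_isRsopPart_one {S : Type} [CommRing S] [IsRegularLocalRing S]
    (hne : maximalIdeal S ≠ ⊥) : ∃ z : Fin 1 → S, IsRsopPart z := by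
  obtain ⟨x, hx⟩ := exists_regularSystemOfParameters (R := S)
  rcases Nat.eq_zero_or_pos (maximalIdeal S).spanFinrank with h0 | hpos
  · exfalso
    apply hne
    have : IsEmpty (Fin (maximalIdeal S).spanFinrank) := by
      rw [h0]
      infer_instance
    rw [← hx, Set.range_eq_empty x, Ideal.span_empty]
  · exact ⟨x ∘ fun _ => ⟨0, hpos⟩,
      isRsopPart_comp_of_rsop rfl x hx _ fun a b _ => Subsingleton.elim a b⟩

/-- Exponent bookkeeping: `∏ᵢ (∏ₗ μₗ ^ e i l) ^ nᵢ = ∏ₗ μₗ ^ (∑ᵢ nᵢ e i l)`. [folklore] -/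
theorem prod_prod_pow_pow {M : Type*} [CommMonoid M] {ι κ : Type*} [Fintype ι] [Fintype κ]
    (μ : κ → M) (e : ι → κ → ℕ) (n : ι → ℕ) :
    ∏ i, (∏ l, μ l ^ e i l) ^ n i = ∏ l, μ l ^ ∑ i, n i * e i l := by
  calc ∏ i, (∏ l, μ l ^ e i l) ^ n i = ∏ i, ∏ l, μ l ^ (n i * e i l) := by
        refine Finset.prod_congr rfl fun i _ => ?_
        rw [← Finset.prod_pow]
        exact Finset.prod_congr rfl fun l _ => by rw [← pow_mul, mul_comm]
    _ = ∏ l, ∏ i, μ l ^ (n i * e i l) := Finset.prod_comm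
    _ = ∏ l, μ l ^ ∑ i, n i * e i l :=
        Finset.prod_congr rfl fun l _ => Finset.prod_pow_eq_pow_sum _ _ _

/-- **Iterating the one-step monomial lemma along the sequence.** If every quadratic transform
along `O` turns members of a part of a regular system of parameters into monomials (in a part of a
regular system of parameters of the transform) times units (hypothesis `h₁` = the statement of
`stub_rsopMonomialStep`), then an element of `K` which is such a monomial times a unit in `R i₀`
is one in every later member `R (i₀ + d)` of a sequence of quadratic transforms along `O` of local
rings dominated by `O`. [cite: HeinzerEtAl2015, Lemma 2.7] -/
theorem exists_monomial_along
    (h₁ : ∀ (K : Type) [Field K] (O : ValuationSubring K) (R R₁ : Subring K) [IsLocalRing R]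
      [IsLocalRing R₁], SubringDominates R O.toSubring → IsQuadraticTransformAlong O R R₁ →
      ∀ (s : ℕ) (z : Fin s → R), IsRsopPart z →
      ∃ (s₁ : ℕ) (z₁ : Fin s₁ → R₁), IsRsopPart z₁ ∧
        ∀ j : Fin s, ∃ (e : Fin s₁ → ℕ) (u : R₁), IsUnit u ∧
          ((z j : R) : K) = (∏ l, ((z₁ l : R₁) : K) ^ e l) * (u : K))
    (O : ValuationSubring K) (R : ℕ → Subring K) [hR : ∀ i, IsLocalRing (R i)]
    (hstep : ∀ i, IsQuadraticTransformAlong O (R i) (R (i + 1)))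
    (hdom : ∀ i, SubringDominates (R i) O.toSubring) (i₀ : ℕ) (x₀ : K)
    (hx : ∃ (s : ℕ) (z : Fin s → R i₀), IsRsopPart z ∧ ∃ (e : Fin s → ℕ) (u : R i₀), IsUnit u ∧
      x₀ = (∏ l, ((z l : R i₀) : K) ^ e l) * (u : K)) (d : ℕ) :
    ∃ (s : ℕ) (z : Fin s → R (i₀ + d)), IsRsopPart z ∧ ∃ (e : Fin s → ℕ) (u : R (i₀ + d)),
      IsUnit u ∧ x₀ = (∏ l, ((z l : R (i₀ + d)) : K) ^ e l) * (u : K) := by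
  classical
  induction d with
  | zero => exact hx
  | succ d ih =>
    obtain ⟨s, z, hz, e, u, hu, hxe⟩ := ih
    obtain ⟨s₁, z₁, hz₁, H⟩ := h₁ K O (R (i₀ + d)) (R (i₀ + d + 1)) (hdom _) (hstep _) s z hz
    choose e' u' hu' hzu' using H
    have hle : R (i₀ + d) ≤ R (i₀ + d + 1) := (hstep _).le
    refine ⟨s₁, z₁, hz₁, fun l => ∑ j, e j * e' j l, (∏ j, u' j ^ e j) * Subring.inclusion hle u,
      (IsUnit.prod_univ_iff.mpr fun j => (hu' j).pow _).mul (hu.map _), ?_⟩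
    rw [hxe]
    simp only [hzu', mul_pow]
    rw [Finset.prod_mul_distrib, prod_prod_pow_pow, mul_assoc]
    push_cast
    simp only [Subring.coe_inclusion]

/-- **A divisor of a monomial is a monomial.** In a regular local ring `S ⊆ O` inside `K`, if
`b, c ∈ S` satisfy `b · c = (∏ zₗ ^ Eₗ) · u` in `K` with `z` part of a regular system of parameters
of `S` and `u` a unit, then `b = (∏ zₗ ^ mₗ) · u'` for some exponents `m` and unit `u'` of `S` (the
`zₗ` are prime elements of the domain `S`). [folklore] -/
theorem exists_monomial_of_mul_eq {S : Subring K} [IsRegularLocalRing S] {s : ℕ}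
    {z : Fin s → S} (hz : IsRsopPart z) (E : Fin s → ℕ) {b c : K} (hb : b ∈ S) (hc : c ∈ S)
    {u : S} (hu : IsUnit u) (h : b * c = (∏ l, ((z l : S) : K) ^ E l) * (u : K)) :
    ∃ (m : Fin s → ℕ) (u' : S), IsUnit u' ∧ b = (∏ l, ((z l : S) : K) ^ m l) * (u' : K) := by
  classical
  have key : (∏ l, z l ^ E l) * u = (⟨b, hb⟩ : S) * ⟨c, hc⟩ :=
    Subtype.ext (by push_cast; exact h.symm)
  have hdvd : (⟨b, hb⟩ : S) ∣ ∏ l, z l ^ E l := hu.dvd_mul_right.mp ⟨⟨c, hc⟩, key⟩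
  obtain ⟨c', m, hm⟩ :=
    CossartPiltantMonomial.exists_eq_units_mul_prod_pow_of_dvd (fun l => hz.prime l) E hdvd
  refine ⟨m, c', c'.isUnit, ?_⟩
  have := congrArg Subtype.val hm
  push_cast at this
  exact this.trans (mul_comm _ _)

end Helpers

/-- **Strongly switching + archimedean + defectless ⇒ torsor LU, from the three worker stubs**
(`stub_rsopMonomialStep`, `stub_switchingSetup`, `stub_switchingExit`, taken as hypotheses with their
statements verbatim). The archimedean argument: the defectless witness `g` lies in `O`, hence in some
member `R i₀` of the quadratic sequence of the base along `O` (strong switching); for a regular parameter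
`x` of `R i₀`, archimedeanity gives `n` with `v(xⁿ) < v(b)`, `b := t ^ p − g ^ p`, so `xⁿ / b ∈ O ∩ Frac A₀`
lies in some `R N` (strong switching): `b ∣ xⁿ` in `R N`, and `xⁿ` is a monomial in a part of a regular
system of parameters of `R N` times a unit (iterating the one-step lemma), hence so is `b` (a divisor of a
product of prime powers, `exists_eq_units_mul_prod_pow_of_dvd`); were all exponents divisible by `p`,
`b = w ^ p · unit` with `w ∈ R N ⊆ Frac A₀` would contradict defectlessness; the exit stub concludes.
[cite: HeinzerEtAl2015, Prop. 4.4] [folklore] -/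
theorem stub_switchingAssembly
    (h₁ : ∀ (K : Type) [Field K] (O : ValuationSubring K) (R R₁ : Subring K) [IsLocalRing R]
      [IsLocalRing R₁], SubringDominates R O.toSubring → IsQuadraticTransformAlong O R R₁ →
      ∀ (s : ℕ) (z : Fin s → R), IsRsopPart z →
      ∃ (s₁ : ℕ) (z₁ : Fin s₁ → R₁), IsRsopPart z₁ ∧
        ∀ j : Fin s, ∃ (e : Fin s₁ → ℕ) (u : R₁), IsUnit u ∧
          ((z j : R) : K) = (∏ l, ((z₁ l : R₁) : K) ^ e l) * (u : K))
    (h₂ : ∀ (k K : Type) [Field k] [Field K] [Algebra k K] (O : ValuationSubring K)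
      (A₀ : Subalgebra k K) (h₀ : A₀.toSubring ≤ O.toSubring),
      IsRegularLocalRing (Localization.AtPrime
        (Ideal.comap (Subring.inclusion h₀) (IsLocalRing.maximalIdeal O))) →
      (∃ a ∈ A₀, a ≠ 0 ∧ O.valuation a < 1) →
      ∃ R : ℕ → Subring K, R 0 = locAtCentre A₀.toSubring O ∧
        (∀ i, IsQuadraticTransformAlong O (R i) (R (i + 1))) ∧ (∀ i, IsRegularLocalRing (R i)) ∧
        (∀ i, SubringDominates (R i) O.toSubring) ∧
        ∀ i, ∀ x ∈ R i, ∃ y ∈ A₀, ∃ z ∈ A₀, z ≠ 0 ∧ x = y / z)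
    (h₃ : ∀ p : ℕ, p.Prime → ∀ (k K : Type) [Field k] [CharP k p] [Field K] [Algebra k K]
      (O : ValuationSubring K) (A₀ : Subalgebra k K) (h₀ : A₀.toSubring ≤ O.toSubring) (t : K),
      A₀.FG → t ^ p ∈ A₀ → IsFractionRing (Algebra.adjoin k (insert t (A₀ : Set K))) K →
      ∀ (R : ℕ → Subring K), R 0 = locAtCentre A₀.toSubring O →
      (∀ i, IsQuadraticTransformAlong O (R i) (R (i + 1))) →
      ∀ (N : ℕ) [IsLocalRing (R N)] (s : ℕ) (z : Fin s → R N), IsRsopPart z →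
      ∀ (g : K), g ∈ R N → ∀ (m : Fin s → ℕ), (∃ l, ¬ p ∣ m l) → ∀ (u : R N), IsUnit u →
      t ^ p - g ^ p = (∏ l, ((z l : R N) : K) ^ m l) * (u : K) →
      ∃ (A : Subalgebra k K) (h : A.toSubring ≤ O.toSubring), A₀ ≤ A ∧ t ∈ A ∧ A.FG ∧
        IsFractionRing A K ∧ IsRegularLocalRing (Localization.AtPrime
          (Ideal.comap (Subring.inclusion h) (IsLocalRing.maximalIdeal O)))) :
    ∀ p : ℕ, p.Prime → ∀ (k K : Type) [Field k] [CharP k p] [Field K] [Algebra k K]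
      (O : ValuationSubring K) (A₀ : Subalgebra k K) (h₀ : A₀.toSubring ≤ O.toSubring) (t : K),
      A₀.FG → t ^ p ∈ A₀ → IsFractionRing (Algebra.adjoin k (insert t (A₀ : Set K))) K →
      IsRegularLocalRing (Localization.AtPrime
        (Ideal.comap (Subring.inclusion h₀) (IsLocalRing.maximalIdeal O))) →
      (∀ R : ℕ → Subring K, R 0 = locAtCentre A₀.toSubring O →
        (∀ i, IsQuadraticTransformAlong O (R i) (R (i + 1))) →
        ∀ x : K, x ∈ O → (∃ y ∈ A₀, ∃ z ∈ A₀, z ≠ 0 ∧ x = y / z) → ∃ i, x ∈ R i) →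
      (∀ x y : K, (∃ a ∈ A₀, ∃ b ∈ A₀, b ≠ 0 ∧ x = a / b) → (∃ a ∈ A₀, ∃ b ∈ A₀, b ≠ 0 ∧ y = a / b) →
        y ≠ 0 → O.valuation x < 1 → ∃ n : ℕ, O.valuation x ^ n < O.valuation y) →
      ¬ (∀ g : K, (∃ a ∈ A₀, ∃ b ∈ A₀, b ≠ 0 ∧ g = a / b) →
        ∃ w : K, (∃ a ∈ A₀, ∃ b ∈ A₀, b ≠ 0 ∧ w = a / b) ∧
          O.valuation (t ^ p - g ^ p) = O.valuation (w ^ p)) →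
      ∃ (A : Subalgebra k K) (h : A.toSubring ≤ O.toSubring), A₀ ≤ A ∧ t ∈ A ∧ A.FG ∧
        IsFractionRing A K ∧ IsRegularLocalRing (Localization.AtPrime
          (Ideal.comap (Subring.inclusion h) (IsLocalRing.maximalIdeal O))) := by
  intro p hp k K _ _ _ _ O A₀ h₀ t hfg htp hfr hreg hSS hArch hnD
  classical
  haveI : Fact p.Prime := ⟨hp⟩
  haveI : CharP K p := charP_of_injective_algebraMap (algebraMap k K).injective p
  have hp0 : p ≠ 0 := hp.ne_zero
  -- fractions of `A₀` = the subfield `F` generated by `A₀`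
  have hF := exists_div_iff_mem_closure A₀
  set F : Subfield K := Subfield.closure (A₀ : Set K) with hFdef
  have hA₀F : ∀ x ∈ A₀, x ∈ F := fun x hx => Subfield.subset_closure hx
  have hA₀O : ∀ x ∈ A₀, x ∈ O := fun x hx => h₀ hx
  -- (1) the defectless witness `g`
  push Not at hnD
  obtain ⟨g, hgfrac, hgw⟩ := hnD
  have hgF : g ∈ F := (hF g).mp hgfrac
  -- (2) `t ∈ O` and `g ∈ O`
  have htO : t ∈ O := by
    by_contra h
    have h1 : 1 < O.valuation t := lt_of_not_ge fun h' => h ((O.valuation_le_one_iff t).mp h')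
    have h2 : O.valuation (t ^ p) ≤ 1 := (O.valuation_le_one_iff _).mpr (hA₀O _ htp)
    rw [map_pow] at h2
    exact not_lt.mpr h2 (one_lt_pow₀ h1 hp0)
  have hgO : g ∈ O := by
    by_contra h
    have h1 : O.valuation t < O.valuation g :=
      lt_of_le_of_lt ((O.valuation_le_one_iff t).mpr htO)
        (lt_of_not_ge fun h' => h ((O.valuation_le_one_iff g).mp h'))
    refine hgw g hgfrac ?_
    rw [← sub_pow_char t g, map_pow, map_pow, Valuation.map_sub_eq_of_lt_right _ h1]
  -- (3) the element `b := t ^ p - g ^ p`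
  have hbF : t ^ p - g ^ p ∈ F := sub_mem (hA₀F _ htp) (pow_mem hgF p)
  have hbO : t ^ p - g ^ p ∈ O := sub_mem (hA₀O _ htp) (pow_mem hgO p)
  generalize hb : t ^ p - g ^ p = b at hgw hbF hbO
  have hb0 : b ≠ 0 := by
    intro h
    refine hgw 0 ⟨0, A₀.zero_mem, 1, A₀.one_mem, one_ne_zero, (div_one 0).symm⟩ ?_
    rw [h, zero_pow hp0]
  have hvb1 : O.valuation b < 1 := by
    refine lt_of_le_of_ne ((O.valuation_le_one_iff b).mpr hbO) fun h => ?_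
    refine hgw 1 ⟨1, A₀.one_mem, 1, A₀.one_mem, one_ne_zero, (div_one 1).symm⟩ ?_
    rw [h, one_pow, map_one]
  -- the centre of `O` on `A₀` is non-zero: the numerator `y` of `b`
  obtain ⟨y, hyA, z', hz'A, hz'0, hbyz⟩ := (hF b).mpr hbF
  have hy0 : y ≠ 0 := by
    rintro rfl
    exact hb0 (by rw [hbyz, zero_div])
  have hvy : O.valuation y < 1 := by
    have hy : y = b * z' := by rw [hbyz, div_mul_cancel₀ _ hz'0]
    rw [hy, map_mul]
    calc O.valuation b * O.valuation z' ≤ O.valuation b * 1 :=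
          mul_le_mul_right ((O.valuation_le_one_iff _).mpr (hA₀O _ hz'A)) _
      _ < 1 := by rw [mul_one]; exact hvb1
  -- (4) the quadratic sequence of the base along `O`
  obtain ⟨R, hR0, hstep, hRreg, hRdom, hRfrac⟩ := h₂ k K O A₀ h₀ hreg ⟨y, hyA, hy0, hvy⟩
  haveI hRinst : ∀ i, IsRegularLocalRing (R i) := hRreg
  have hmono : Monotone R := sequence_monotone hstep
  have hRO : ∀ i, R i ≤ O.toSubring := fun i => (hRdom i).1
  have hA₀R : ∀ i, ∀ x ∈ A₀, x ∈ R i := fun i x hx =>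
    hmono (Nat.zero_le i) (by rw [hR0]; exact le_locAtCentre A₀.toSubring O hx)
  have hmax : ∀ i (a : R i), a ∈ maximalIdeal (R i) ↔ O.valuation (a : K) < 1 := fun i =>
    (subringDominates_valuationSubring_iff (hRO i)).mp (hRdom i)
  -- (5) `g ∈ R i₀`; a regular parameter `x₀ := z₀ 0` of `R i₀`
  obtain ⟨i₀, hgi₀⟩ := hSS R hR0 hstep g hgO hgfrac
  have hne : maximalIdeal (R i₀) ≠ ⊥ := by
    intro hbot
    have hym : (⟨y, hA₀R i₀ y hyA⟩ : R i₀) ∈ maximalIdeal (R i₀) := (hmax i₀ _).mpr hvy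
    rw [hbot, Ideal.mem_bot] at hym
    exact hy0 (congrArg Subtype.val hym)
  obtain ⟨z₀, hz₀⟩ := exists_isRsopPart_one hne
  have hx₀0 : ((z₀ 0 : R i₀) : K) ≠ 0 := fun h => hz₀.ne_zero 0 (Subtype.ext h)
  have hvx₀ : O.valuation ((z₀ 0 : R i₀) : K) < 1 := (hmax i₀ _).mp (hz₀.mem_maximalIdeal 0)
  have hx₀frac := hRfrac i₀ _ (z₀ 0).2
  have hx₀F : ((z₀ 0 : R i₀) : K) ∈ F := (hF _).mp hx₀frac
  have hbase : ∃ (s : ℕ) (z : Fin s → R i₀), IsRsopPart z ∧ ∃ (e : Fin s → ℕ) (u : R i₀),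
      IsUnit u ∧ ((z₀ 0 : R i₀) : K) = (∏ l, ((z l : R i₀) : K) ^ e l) * (u : K) :=
    ⟨1, z₀, hz₀, fun _ => 1, 1, isUnit_one, by simp⟩
  -- (7) the archimedean step: `c := x₀ ^ n / b ∈ O ∩ Frac A₀` lies in some `R N₁`
  obtain ⟨n, hn⟩ := hArch _ b hx₀frac ((hF b).mpr hbF) hb0 hvx₀
  have hvc : O.valuation (((z₀ 0 : R i₀) : K) ^ n / b) < 1 := by
    rw [map_div₀, map_pow, div_lt_one₀ ((Valuation.pos_iff _).mpr hb0)]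
    exact hn
  have hcO : ((z₀ 0 : R i₀) : K) ^ n / b ∈ O := (O.valuation_le_one_iff _).mp hvc.le
  have hcF : ((z₀ 0 : R i₀) : K) ^ n / b ∈ F := div_mem (pow_mem hx₀F n) hbF
  obtain ⟨N₁, hcN₁⟩ := hSS R hR0 hstep _ hcO ((hF _).mpr hcF)
  -- (6) everything in `R N`, `N := i₀ + N₁`, where `x₀` is a monomial times a unit
  obtain ⟨s, zN, hzN, eN, uN, huN, hx₀eq⟩ :=
    exists_monomial_along h₁ O R hstep hRdom i₀ _ hbase N₁
  have hcN : ((z₀ 0 : R i₀) : K) ^ n / b ∈ R (i₀ + N₁) := hmono (Nat.le_add_left N₁ i₀) hcN₁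
  have hgN : g ∈ R (i₀ + N₁) := hmono (Nat.le_add_right i₀ N₁) hgi₀
  have hbN : b ∈ R (i₀ + N₁) := by
    rw [← hb]
    exact sub_mem (hA₀R _ _ htp) (pow_mem hgN p)
  -- (8) `b · c = x₀ ^ n` is a monomial times a unit, hence so is `b`
  have hbc : b * (((z₀ 0 : R i₀) : K) ^ n / b) =
      (∏ l, ((zN l : R (i₀ + N₁)) : K) ^ (n * eN l)) * ((uN ^ n : R (i₀ + N₁)) : K) := by
    rw [mul_div_cancel₀ _ hb0, hx₀eq, mul_pow, ← Finset.prod_pow, SubmonoidClass.coe_pow]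
    refine congrArg (· * _) (Finset.prod_congr rfl fun l _ => ?_)
    rw [← pow_mul, mul_comm]
  obtain ⟨m, u', hu', hbm⟩ :=
    exists_monomial_of_mul_eq hzN (fun l => n * eN l) hbN hcN (huN.pow n) hbc
  -- (9) some exponent is prime to `p` (defectlessness)
  have hex : ∃ l, ¬ p ∣ m l := by
    by_contra hall
    push Not at hall
    set w : R (i₀ + N₁) := ∏ l, zN l ^ (m l / p) with hw
    have hwp : (w : K) ^ p = ∏ l, ((zN l : R (i₀ + N₁)) : K) ^ m l := by
      rw [hw]
      push_cast
      rw [← Finset.prod_pow]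
      exact Finset.prod_congr rfl fun l _ => by rw [← pow_mul, Nat.div_mul_cancel (hall l)]
    refine hgw w (hRfrac _ _ w.2) ?_
    rw [hbm, ← hwp, map_mul, valuation_eq_one_of_isUnit_subring (hRO _) hu', mul_one]
  -- (10) exit
  exact h₃ p hp k K O A₀ h₀ t hfg htp hfr R hR0 hstep (i₀ + N₁) s zN hzN g hgN m hex u' hu'
    (hb.trans hbm)

end Summit.ResolutionOfSingularities.ResolutionOfSingularities.Theorems.SwitchingDichotomy
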